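import Literature.Geometry.Kaehler.RiemannSurfaceLinearCharactersCommutatorQuotient
import Mathlib.RingTheory.IntegralDomain
import HarnessLib

/-!
# The linear characters of `G` trivial on `N ⊇ G'` in `𝓗¹(M)`: `⊕_{χ(N) = 1} E_χ = 𝓗¹(M)^N`, `Σ_{χ(N) = 1} dim E_χ = g(M/N)`,
# and the cyclic tower `Σ_{k mod o(χ)} dim E_{χᵏ} = g(M/ker χ)` (Kopeliovich–Zemel Thm 7.3 / Cor 7.4, Farkas–Kra V.2.2)

Layer `Literature/Geometry/Kaehler`, sequel of `RiemannSurfaceLinearCharactersCommutatorQuotient` (`N = G'`) and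
`RiemannSurfaceCyclicQuotientEigenspaces` (the powers `χᵏ`, `k` prime to `o(χ)`). For a finite group `G`, a normal
subgroup `N` with `G' = [G, G] ≤ N` (so `G/N` is abelian) and a finite-dimensional complex representation `(W, σ)`, the
linear characters `χ ∈ Ĝ` with `χ(N) = 1` are the characters of `G/N`, and Serre's projectors
`P_χ = |G|⁻¹ Σ_h χ(h)⁻¹ σ(h)` (file `RiemannSurfaceAbelianGroupEigenspaceDecomposition`) add up over them to the
averaging operator of `N`:

  `Σ_{χ ∈ Ĝ, χ(N) = 1} P_χ = |N|⁻¹ Σ_{h ∈ N} σ(h)`, `⊕_{χ(N) = 1} E_χ(W) = W^N`, `Σ_{χ(N) = 1} dim E_χ(W) = dim W^N`.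

For one linear character `χ` of order `n = o(χ)` and `N = ker χ` the quotient `Q = G/N` is CYCLIC of order `n`
(«characters of `G` map `G` onto finite (hence cyclic) subgroups of `S¹`»), the characters trivial on `N` are exactly
the `n` powers `χᵏ`, and `Σ_{k mod n} dim E_{χᵏ}(W) = dim W^{ker χ}`. For `W = 𝓗¹(M)`, `G ≤ Aut M` (Farkas–Kra V.2.2:
`dim 𝓗¹(M)^N = g(M/N)`): `Σ_{χ(N)=1} dim E_χ = g(M/N)` and `Σ_{k mod o(χ)} dim E_{χᵏ} = g(M/ker χ)` — the tangent
space at `0` of the part of `J(X)` coming from `J(Y_Q)`, `Y_Q = X/ker χ`. Sources as printed: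

Y. Kopeliovich, S. Zemel, Israel J. Math. 234 (2019) (arXiv:1609.02296 p. 32), proof of Theorem 7.3:
> As characters of `G` map `G` onto finite (hence cyclic) subgroups of `S¹`, each such character becomes a faithful
> character of a cyclic quotient `Q = G/N` of `G`.
and after Corollary 7.4 (p. 32): «we choose a generator `χ` for the cyclic subgroup of `Ĝ` that is associated with
`Q` […] The associated number `β` […] is `o(χ)`, or equivalently `|Q|`»; proof of Corollary 7.4 (p. 33):
> Therefore it suffices to investigate `J(Y_Q)` as a representation of `Q`. […] The other parts of `J(Y_Q)` (or its
> image in `J(X)`), that come from non-invertible powers of a character `χ ∈ Ĝ` that reduces to a faithful character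
> of `Q`, are, via the same argument, images of primitive Prym varieties of coarser quotients.

J.-P. Serre, *Linear Representations of Finite Groups*, §2.6 Theorem 8 (the projectors `p_i = (n_i/g) Σ_t χ_i(t)* ρ_t`);
H. M. Farkas, I. Kra, *Riemann Surfaces*, V.2.2 Corollary (`dim 𝓗¹_N(M) = g(M/N)`).

(`J(X)`, `J(Y_Q)` and Prym varieties are not formalised here — the statements are about `Ω(1) = 𝓗¹(M)`, the
cotangent space of `J(X)` at `0`.)

## What is proved (no definitions, no named facts, no instances)

* §1 (finite `G`, `N ⊴ G`, `G' ≤ N`): `mul_comm_quotient_of_commutator_le`, **`sum_filter_char_coe_apply_eq_ite`**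
  (`Σ_{χ(N)=1} χ(h) = [G:N]·[h ∈ N]`), `card_filter_ker_le_eq_index` (`#{χ ∈ Ĝ : χ(N) = 1} = [G:N]`);
* §2 (finite-dimensional `(W, σ)`): **`sum_filter_proj_eq_inv_card_smul_sum`** (`Σ_{χ(N)=1} P_χ = |N|⁻¹ Σ_{h ∈ N} σ(h)`),
  `iInf_eigenspace_le_invariants_of_le_ker` (`E_χ ⊆ W^N` for `N ≤ ker χ`), **`biSup_iInf_eigenspace_eq_invariants`**
  (`⊕_{χ(N)=1} E_χ = W^N`), **`sum_filter_finrank_iInf_eigenspace_eq_finrank_invariants`**,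
  `finsum_mem_finrank_iInf_eigenspace_eq_finrank_invariants` (`Σ_{χ(N)=1} dim E_χ(W) = dim W^N`);
* §3 (one linear character `χ`, `N = ker χ`): **`isCyclic_quotient_ker_char`** (`G/ker χ` is cyclic),
  **`index_ker_eq_orderOf`** (`[G : ker χ] = o(χ)`), `orderOf_mul_card_ker_eq_card`, **`filter_ker_le_ker_eq_image_pow`**
  (the characters trivial on `ker χ` are the `χᵏ`, `k < o(χ)`), `sum_range_pow_coe_apply_eq_ite`
  (`Σ_{k<o(χ)} χ(h)ᵏ = o(χ)·[χ(h) = 1]`), **`sum_range_proj_pow_eq_inv_card_smul_sum`** (`Σ_k P_{χᵏ} = |ker χ|⁻¹ Σ_{ker χ} σ`),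
  **`iSup_iInf_eigenspace_pow_eq_invariants_ker`** (`⊕_k E_{χᵏ} = W^{ker χ}`),
  **`sum_range_finrank_iInf_eigenspace_pow_eq_finrank_invariants`** (`Σ_{k<o(χ)} dim E_{χᵏ}(W) = dim W^{ker χ}`);
* §4 for `G ≤ Aut M` (subgroups of `G` pushed into `Aut M` by `Subgroup.map G.subtype`):
  **`finsum_mem_finrank_iInf_eigenspace_oneFormRep_eq_arithGenus`**
  (`Σ_{χ(N)=1} dim E_χ(𝓗¹(M)) = g(M/N)`), **`sum_range_finrank_iInf_eigenspace_pow_oneFormRep_eq_arithGenus`**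
  (`Σ_{k<o(χ)} dim E_{χᵏ}(𝓗¹(M)) = g(M/ker χ)`).

## References

* Y. Kopeliovich, S. Zemel, *On spaces associated with invariant divisors on Galois covers of Riemann surfaces and
  their applications*, Israel J. Math. 234 (2019), §7, Theorem 7.3, Corollary 7.4 (arXiv:1609.02296 pp. 32–33).
  [KopeliovichZemel2019]
* J.-P. Serre, *Linear Representations of Finite Groups*, GTM 42 (1977), §2.6 Theorem 8, §3.1.
  [SerreLinearRepresentations1977]
* H. M. Farkas, I. Kra, *Riemann Surfaces*, GTM 71, 2nd ed. (1992), V.2.2 Corollary. [FarkasKra1992]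
-/

noncomputable section

open scoped Manifold ContDiff Topology
open Set Filter Function Complex MulAction Module

namespace Literature.Geometry.Kaehler

namespace RiemannSurface

/-! ### §1 The linear characters trivial on `N ⊇ G'` are the characters of `G/N` -/

section Characters

variable {G : Type*} [Group G] [Fintype G]

omit [Fintype G] in
/-- `G/N` is commutative when `G' ≤ N` (Mathlib: `Subgroup.Normal.quotient_commutative_iff_commutator_le`).
[cite: SerreLinearRepresentations1977, §3.1] -/
theorem mul_comm_quotient_of_commutator_le (N : Subgroup G) [N.Normal] (hN : commutator G ≤ N) (x y : G ⧸ N) :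
    x * y = y * x :=
  (Subgroup.Normal.quotient_commutative_iff_commutator_le.2 hN).is_comm.comm x y

/-- **`Σ_{χ ∈ Ĝ, χ(N) = 1} χ(h) = [G : N]·[h ∈ N]`** for `G' ≤ N ⊴ G`: the characters of `G` trivial on `N` are the
characters of the abelian group `G/N` (pulled back along `G → G/N`), to which column orthogonality
(`sum_char_coe_apply_eq_ite`) applies. [cite: SerreLinearRepresentations1977, §2.6 Theorem 8 (proof), §3.1]
[cite: KopeliovichZemel2019, Theorem 7.3 (proof)] -/
theorem sum_filter_char_coe_apply_eq_ite (N : Subgroup G) [N.Normal] (hN : commutator G ≤ N) [Fintype (G →* ℂˣ)]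
    [DecidablePred fun χ : G →* ℂˣ ↦ N ≤ χ.ker] [DecidablePred (· ∈ N)] (h : G) :
    ∑ χ ∈ Finset.univ.filter (fun χ : G →* ℂˣ ↦ N ≤ χ.ker), ((χ h : ℂˣ) : ℂ) =
      if h ∈ N then (N.index : ℂ) else 0 := by
  classical
  haveI : Fintype (G ⧸ N) := Fintype.ofFinite _
  haveI : Fintype (G ⧸ N →* ℂˣ) := Fintype.ofFinite _
  -- reindex by the characters of `G/N`
  have hre : ∑ χ ∈ Finset.univ.filter (fun χ : G →* ℂˣ ↦ N ≤ χ.ker), ((χ h : ℂˣ) : ℂ) =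
      ∑ ψ : G ⧸ N →* ℂˣ, ((ψ (h : G ⧸ N) : ℂˣ) : ℂ) := by
    refine Finset.sum_bij' (fun χ hχ ↦ QuotientGroup.lift N χ (Finset.mem_filter.1 hχ).2)
      (fun ψ _ ↦ ψ.comp (QuotientGroup.mk' N)) (fun χ hχ ↦ Finset.mem_univ _) (fun ψ _ ↦ ?_) (fun χ hχ ↦ ?_)
      (fun ψ _ ↦ ?_) (fun χ hχ ↦ ?_)
    · refine Finset.mem_filter.2 ⟨Finset.mem_univ _, fun g hg ↦ ?_⟩
      rw [MonoidHom.mem_ker, MonoidHom.comp_apply, QuotientGroup.mk'_apply, (QuotientGroup.eq_one_iff g).2 hg,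
        map_one]
    · exact MonoidHom.ext fun g ↦ by rw [MonoidHom.comp_apply, QuotientGroup.mk'_apply, QuotientGroup.lift_mk]
    · refine QuotientGroup.monoidHom_ext N (MonoidHom.ext fun g ↦ ?_)
      rw [MonoidHom.comp_apply, QuotientGroup.mk'_apply, QuotientGroup.lift_mk, MonoidHom.comp_apply,
        QuotientGroup.mk'_apply]
    · rw [QuotientGroup.lift_mk]
  rw [hre, sum_char_coe_apply_eq_ite (G := G ⧸ N) (mul_comm_quotient_of_commutator_le N hN) (h : G ⧸ N),
    Subgroup.index_eq_card]
  by_cases hh : h ∈ N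
  · rw [if_pos ((QuotientGroup.eq_one_iff h).2 hh), if_pos hh]
  · rw [if_neg (mt (QuotientGroup.eq_one_iff h).1 hh), if_neg hh]

/-- **`#{χ ∈ Ĝ : χ(N) = 1} = [G : N]`** for `G' ≤ N ⊴ G` (`= |Hom(G/N, ℂˣ)| = |G/N|`).
[cite: SerreLinearRepresentations1977, §3.1] [cite: KopeliovichZemel2019, Theorem 7.3 (proof)] -/
theorem card_filter_ker_le_eq_index (N : Subgroup G) [N.Normal] (hN : commutator G ≤ N) [Fintype (G →* ℂˣ)]
    [DecidablePred fun χ : G →* ℂˣ ↦ N ≤ χ.ker] :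
    (Finset.univ.filter (fun χ : G →* ℂˣ ↦ N ≤ χ.ker)).card = N.index := by
  classical
  have h := sum_filter_char_coe_apply_eq_ite N hN (1 : G)
  simp only [map_one, Units.val_one, Finset.sum_const, nsmul_eq_mul, mul_one, if_pos N.one_mem] at h
  exact_mod_cast h

end Characters

/-! ### §2 `Σ_{χ(N) = 1} P_χ` is the averaging operator of `N`; `⊕_{χ(N)=1} E_χ = W^N` -/

section Projectors

variable {G : Type*} [Group G] [Fintype G] {W : Type*} [AddCommGroup W] [Module ℂ W] (σ : Representation ℂ G W)

/-- **`Σ_{χ ∈ Ĝ, χ(N) = 1} P_χ = |N|⁻¹ Σ_{h ∈ N} σ(h)`** for `G' ≤ N ⊴ G` (`Σ_{χ(N)=1} χ(h)⁻¹ = [G:N]·[h ∈ N]` and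
`[G:N]·|N| = |G|`). [cite: SerreLinearRepresentations1977, §2.6 Theorem 8] -/
theorem sum_filter_proj_eq_inv_card_smul_sum (N : Subgroup G) [N.Normal] (hN : commutator G ≤ N)
    [Fintype (G →* ℂˣ)] [DecidablePred fun χ : G →* ℂˣ ↦ N ≤ χ.ker] [DecidablePred (· ∈ N)] :
    ∑ χ ∈ Finset.univ.filter (fun χ : G →* ℂˣ ↦ N ≤ χ.ker), ((Fintype.card G : ℂ)⁻¹ • ∑ h : G, ((χ h : ℂ)⁻¹ • σ h)) =
      (Nat.card ↥N : ℂ)⁻¹ • ∑ h ∈ Finset.univ.filter (· ∈ N), σ h := by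
  rw [← Finset.smul_sum, Finset.sum_comm]
  have hinner : ∀ h : G, ∑ χ ∈ Finset.univ.filter (fun χ : G →* ℂˣ ↦ N ≤ χ.ker), ((χ h : ℂ)⁻¹ • σ h) =
      (if h ∈ N then (N.index : ℂ) else 0) • σ h := by
    intro h
    rw [← Finset.sum_smul]
    congr 1
    have : ∀ χ : G →* ℂˣ, ((χ h : ℂ))⁻¹ = ((χ h⁻¹ : ℂˣ) : ℂ) := fun χ ↦ by
      rw [map_inv, Units.val_inv_eq_inv_val]
    simp only [this, sum_filter_char_coe_apply_eq_ite N hN, inv_mem_iff]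
  simp only [hinner]
  rw [← Finset.sum_filter_add_sum_filter_not Finset.univ (· ∈ N)]
  have h0 : ∑ h ∈ Finset.univ.filter (fun h : G ↦ ¬ h ∈ N), (if h ∈ N then (N.index : ℂ) else 0) • σ h = 0 :=
    Finset.sum_eq_zero fun h hh ↦ by rw [if_neg (Finset.mem_filter.1 hh).2, zero_smul]
  rw [h0, add_zero, Finset.sum_congr rfl fun h hh ↦ by rw [if_pos (Finset.mem_filter.1 hh).2], ← Finset.smul_sum,
    smul_smul]
  congr 1
  -- `|G|⁻¹·[G:N] = |N|⁻¹`
  have hcard : (N.index : ℂ) * Nat.card ↥N = Fintype.card G := by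
    rw [← Nat.card_eq_fintype_card, ← Subgroup.index_mul_card N, Nat.cast_mul]
  have hN' : (Nat.card ↥N : ℂ) ≠ 0 := Nat.cast_ne_zero.2 Nat.card_pos.ne'
  have hG : (Fintype.card G : ℂ) ≠ 0 := Nat.cast_ne_zero.2 Fintype.card_ne_zero
  field_simp
  rw [← hcard]

omit [Fintype G] in
/-- `E_χ ⊆ W^N` whenever `χ(N) = 1`. [cite: SerreLinearRepresentations1977, §2.6 Theorem 8]
[cite: KopeliovichZemel2019, Theorem 7.3 (proof)] -/
theorem iInf_eigenspace_le_invariants_of_le_ker {N : Subgroup G} {χ : G →* ℂˣ} (hχ : N ≤ χ.ker) :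
    (⨅ g : G, Module.End.eigenspace (σ g) (χ g : ℂ)) ≤ Representation.invariants (σ.comp N.subtype) := by
  intro v hv
  rw [Submodule.mem_iInf] at hv
  rw [Representation.mem_invariants]
  intro k
  have hk : χ (k : G) = 1 := hχ k.2
  rw [MonoidHom.comp_apply, Subgroup.subtype_apply, Module.End.mem_eigenspace_iff.1 (hv k), hk, Units.val_one,
    one_smul]

/-- **`⊕_{χ ∈ Ĝ, χ(N) = 1} E_χ(W) = W^N`** for `G' ≤ N ⊴ G`: the sum of the eigenspaces of the characters trivial on
`N` is the subspace on which `G` acts through `G/N` (`v = Σ_{χ(N)=1} P_χ v` for `v ∈ W^N`).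
[cite: SerreLinearRepresentations1977, §2.6 Theorem 8] [cite: KopeliovichZemel2019, §7] -/
theorem biSup_iInf_eigenspace_eq_invariants (N : Subgroup G) [N.Normal] (hN : commutator G ≤ N) :
    (⨆ χ ∈ {χ : G →* ℂˣ | N ≤ χ.ker}, ⨅ g : G, Module.End.eigenspace (σ g) (χ g : ℂ)) =
      Representation.invariants (σ.comp N.subtype) := by
  classical
  haveI : Fintype (G →* ℂˣ) := Fintype.ofFinite _
  refine le_antisymm (iSup₂_le fun χ hχ ↦ iInf_eigenspace_le_invariants_of_le_ker σ hχ) fun v hv ↦ ?_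
  -- `v = Σ_{χ(N)=1} P_χ v`
  have hsum := congrArg (fun f : W →ₗ[ℂ] W ↦ f v) (sum_filter_proj_eq_inv_card_smul_sum σ N hN)
  simp only [LinearMap.sum_apply, LinearMap.smul_apply] at hsum
  have hfix : ∀ h ∈ Finset.univ.filter (· ∈ N), σ h v = v := fun h hh ↦ by
    have := hv ⟨h, (Finset.mem_filter.1 hh).2⟩
    rwa [MonoidHom.comp_apply, Subgroup.subtype_apply] at this
  rw [Finset.sum_congr rfl hfix, Finset.sum_const, ← Nat.cast_smul_eq_nsmul ℂ, smul_smul] at hsum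
  have hcard : (Finset.univ.filter (· ∈ N)).card = Nat.card ↥N := by
    rw [Nat.card_eq_fintype_card, Fintype.card_subtype]
  rw [hcard, inv_mul_cancel₀ (Nat.cast_ne_zero.2 Nat.card_pos.ne'), one_smul] at hsum
  rw [← hsum]
  refine Submodule.sum_mem _ fun χ hχ ↦ ?_
  have hχ' : χ ∈ {χ : G →* ℂˣ | N ≤ χ.ker} := (Finset.mem_filter.1 hχ).2
  refine Submodule.mem_iSup_of_mem χ (Submodule.mem_iSup_of_mem hχ' ?_)
  have hmem := (isProj_iInf_eigenspace σ χ).map_mem v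
  simpa only [LinearMap.smul_apply, LinearMap.sum_apply] using hmem

/-- **`Σ_{χ ∈ Ĝ, χ(N) = 1} dim E_χ(W) = dim W^N`** for `G' ≤ N ⊴ G` (`tr Σ_{χ(N)=1} P_χ = |N|⁻¹ Σ_{h ∈ N} tr σ(h)`);
with `iSupIndep_iInf_eigenspace` and `biSup_iInf_eigenspace_eq_invariants`: `W^N = ⊕_{χ(N)=1} E_χ`.
[cite: SerreLinearRepresentations1977, §2.6 Theorem 8] [cite: KopeliovichZemel2019, §7] -/
theorem sum_filter_finrank_iInf_eigenspace_eq_finrank_invariants [FiniteDimensional ℂ W] (N : Subgroup G) [N.Normal]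
    (hN : commutator G ≤ N) [Fintype (G →* ℂˣ)] [DecidablePred fun χ : G →* ℂˣ ↦ N ≤ χ.ker] :
    ∑ χ ∈ Finset.univ.filter (fun χ : G →* ℂˣ ↦ N ≤ χ.ker), finrank ℂ ↥(⨅ g : G, Module.End.eigenspace (σ g) (χ g : ℂ)) =
      finrank ℂ ↥(Representation.invariants (σ.comp N.subtype)) := by
  classical
  have h := congrArg (LinearMap.trace ℂ W) (sum_filter_proj_eq_inv_card_smul_sum σ N hN)
  rw [map_sum, Finset.sum_congr rfl fun χ _ ↦ trace_proj_eq_finrank σ χ, map_smul, map_sum] at h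
  -- `Σ_{h ∈ N} tr σ(h) = |N|·dim W^N`
  have hsub : ∑ h ∈ Finset.univ.filter (· ∈ N), LinearMap.trace ℂ W (σ h) =
      ∑ k : ↥N, LinearMap.trace ℂ W ((σ.comp N.subtype) k) := by
    rw [Finset.sum_subtype (Finset.univ.filter (· ∈ N)) (p := (· ∈ N)) (fun x ↦ by simp)]
    rfl
  rw [hsub, sum_trace_eq_card_mul_finrank_invariants (σ.comp N.subtype), smul_eq_mul, ← mul_assoc,
    ← Nat.card_eq_fintype_card (α := ↥N), inv_mul_cancel₀ (Nat.cast_ne_zero.2 Nat.card_pos.ne'), one_mul] at h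
  exact_mod_cast h

/-- `Σ_{χ(N)=1} dim E_χ(W) = dim W^N` as a finite sum over the set `{χ ∈ Ĝ : N ≤ ker χ}` (no decidability or
`Fintype` hypotheses). [cite: SerreLinearRepresentations1977, §2.6 Theorem 8] -/
theorem finsum_mem_finrank_iInf_eigenspace_eq_finrank_invariants [FiniteDimensional ℂ W] (N : Subgroup G) [N.Normal]
    (hN : commutator G ≤ N) :
    ∑ᶠ χ ∈ {χ : G →* ℂˣ | N ≤ χ.ker}, finrank ℂ ↥(⨅ g : G, Module.End.eigenspace (σ g) (χ g : ℂ)) =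
      finrank ℂ ↥(Representation.invariants (σ.comp N.subtype)) := by
  classical
  haveI : Fintype (G →* ℂˣ) := Fintype.ofFinite _
  rw [← Finset.coe_filter_univ, finsum_mem_coe_finset]
  exact sum_filter_finrank_iInf_eigenspace_eq_finrank_invariants σ N hN

end Projectors

/-! ### §3 One linear character: `G/ker χ` is cyclic of order `o(χ)`, `{ψ : ψ(ker χ) = 1} = {χᵏ}` -/

section Cyclic

variable {G : Type*} [Group G] [Fintype G] (χ : G →* ℂˣ)

omit [Fintype G] in
/-- **`Q = G/ker χ` is cyclic** («characters of `G` map `G` onto finite (hence cyclic) subgroups of `S¹`, each such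
character becomes a faithful character of a cyclic quotient `Q = G/N`»). [cite: KopeliovichZemel2019, Theorem 7.3 (proof)] -/
theorem isCyclic_quotient_ker_char [Finite G] : IsCyclic (G ⧸ χ.ker) :=
  isCyclic_of_injective_ringHom ((Units.coeHom ℂ).comp (QuotientGroup.kerLift χ))
    (Units.val_injective.comp (QuotientGroup.kerLift_injective χ))

omit [Fintype G] in
/-- **`[G : ker χ] = o(χ)`**: the order of the cyclic quotient `Q = G/ker χ` is the order of `χ` in `Ĝ` («the
associated number `β` is `o(χ)`, or equivalently `|Q|`»). [cite: KopeliovichZemel2019, Theorem 7.3 (proof), Corollary 7.4] -/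
theorem index_ker_eq_orderOf [Finite G] : χ.ker.index = orderOf χ := by
  haveI := isCyclic_quotient_ker_char χ
  rw [Subgroup.index_eq_card, ← IsCyclic.exponent_eq_card]
  refine Nat.dvd_antisymm ?_ ?_
  · rw [Monoid.exponent_dvd_iff_forall_pow_eq_one]
    intro q
    obtain ⟨g, rfl⟩ := QuotientGroup.mk_surjective q
    rw [← QuotientGroup.mk_pow, QuotientGroup.eq_one_iff, MonoidHom.mem_ker, map_pow, ← MonoidHom.pow_apply,
      pow_orderOf_eq_one, MonoidHom.one_apply]
  · rw [orderOf_dvd_iff_pow_eq_one]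
    refine MonoidHom.ext fun g ↦ ?_
    have hg : g ^ Monoid.exponent (G ⧸ χ.ker) ∈ χ.ker := by
      rw [← QuotientGroup.eq_one_iff, QuotientGroup.mk_pow]
      exact Monoid.pow_exponent_eq_one _
    rw [MonoidHom.pow_apply, ← map_pow, MonoidHom.one_apply]
    exact hg

omit [Fintype G] in
/-- `o(χ)·|ker χ| = |G|`. [cite: KopeliovichZemel2019, Theorem 7.3 (proof)] -/
theorem orderOf_mul_card_ker_eq_card [Finite G] : orderOf χ * Nat.card ↥χ.ker = Nat.card G := by
  rw [← index_ker_eq_orderOf, Subgroup.index_mul_card]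

omit [Fintype G] in
/-- Reindexing a sum over the pairwise distinct powers `χᵏ`, `k < o(χ)`. [folklore] -/
private theorem sum_image_pow_eq_sum_range [DecidableEq (G →* ℂˣ)] {α : Type*} [AddCommMonoid α] (f : (G →* ℂˣ) → α) :
    ∑ ψ ∈ (Finset.range (orderOf χ)).image (χ ^ ·), f ψ = ∑ k ∈ Finset.range (orderOf χ), f (χ ^ k) :=
  Finset.sum_image fun a ha b hb hab ↦
    pow_injOn_Iio_orderOf (x := χ) (by simpa using ha) (by simpa using hb) hab

/-- **The characters trivial on `ker χ` are exactly the powers `χᵏ`, `0 ≤ k < o(χ)`** («we choose a generator `χ` for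
the cyclic subgroup of `Ĝ` that is associated with `Q`»): both sets have `[G : ker χ] = o(χ)` elements.
[cite: KopeliovichZemel2019, Theorem 7.3 (proof), Corollary 7.4] -/
theorem filter_ker_le_ker_eq_image_pow [Fintype (G →* ℂˣ)] [DecidableEq (G →* ℂˣ)]
    [DecidablePred fun ψ : G →* ℂˣ ↦ χ.ker ≤ ψ.ker] :
    Finset.univ.filter (fun ψ : G →* ℂˣ ↦ χ.ker ≤ ψ.ker) = (Finset.range (orderOf χ)).image (χ ^ ·) := by
  symm
  apply Finset.eq_of_subset_of_card_le
  · intro ψ hψ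
    obtain ⟨k, -, rfl⟩ := Finset.mem_image.1 hψ
    rw [Finset.mem_filter]
    refine ⟨Finset.mem_univ _, fun g hg ↦ ?_⟩
    rw [MonoidHom.mem_ker] at hg ⊢
    rw [MonoidHom.pow_apply, hg, one_pow]
  · rw [card_filter_ker_le_eq_index χ.ker (Abelianization.commutator_subset_ker χ), index_ker_eq_orderOf,
      Finset.card_image_of_injOn (by rw [Finset.coe_range]; exact pow_injOn_Iio_orderOf), Finset.card_range]

omit [Fintype G] in
/-- `χᵏ(h) = χ(h)ᵏ` is trivial on `ker χ`; membership form of `filter_ker_le_ker_eq_image_pow`: a character trivial on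
`ker χ` is a power of `χ`. [cite: KopeliovichZemel2019, Theorem 7.3 (proof)] -/
theorem exists_pow_eq_of_ker_le_ker [Finite G] {ψ : G →* ℂˣ} (hψ : χ.ker ≤ ψ.ker) : ∃ k < orderOf χ, χ ^ k = ψ := by
  classical
  haveI : Fintype G := Fintype.ofFinite _
  haveI : Fintype (G →* ℂˣ) := Fintype.ofFinite _
  have h : ψ ∈ Finset.univ.filter (fun ψ : G →* ℂˣ ↦ χ.ker ≤ ψ.ker) := Finset.mem_filter.2 ⟨Finset.mem_univ _, hψ⟩
  rw [filter_ker_le_ker_eq_image_pow χ, Finset.mem_image] at h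
  obtain ⟨k, hk, rfl⟩ := h
  exact ⟨k, Finset.mem_range.1 hk, rfl⟩

/-- **`Σ_{k < o(χ)} χ(h)ᵏ = o(χ)·[χ(h) = 1]`** (column orthogonality for the cyclic group `G/ker χ`).
[cite: SerreLinearRepresentations1977, §2.6 Theorem 8 (proof)] [cite: KopeliovichZemel2019, Theorem 7.3 (proof)] -/
theorem sum_range_pow_coe_apply_eq_ite [DecidableEq ℂˣ] (h : G) :
    ∑ k ∈ Finset.range (orderOf χ), ((χ h : ℂˣ) : ℂ) ^ k = if χ h = 1 then (orderOf χ : ℂ) else 0 := by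
  classical
  haveI : Fintype (G →* ℂˣ) := Fintype.ofFinite _
  have h1 := sum_filter_char_coe_apply_eq_ite χ.ker (Abelianization.commutator_subset_ker χ) h
  rw [filter_ker_le_ker_eq_image_pow χ, sum_image_pow_eq_sum_range χ, index_ker_eq_orderOf] at h1
  simp only [MonoidHom.pow_apply, Units.val_pow_eq_pow_val, MonoidHom.mem_ker] at h1
  by_cases hh : χ h = 1
  · rw [if_pos hh] at h1 ⊢
    exact h1
  · rw [if_neg hh] at h1 ⊢
    exact h1

variable {W : Type*} [AddCommGroup W] [Module ℂ W] (σ : Representation ℂ G W)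

/-- **`Σ_{k < o(χ)} P_{χᵏ} = |ker χ|⁻¹ Σ_{h ∈ ker χ} σ(h)`**: the projectors onto the eigenspaces of the powers of
`χ` add up to the averaging operator of `N = ker χ`. [cite: SerreLinearRepresentations1977, §2.6 Theorem 8]
[cite: KopeliovichZemel2019, Theorem 7.3, Corollary 7.4 (proof)] -/
theorem sum_range_proj_pow_eq_inv_card_smul_sum [DecidablePred (· ∈ χ.ker)] :
    ∑ k ∈ Finset.range (orderOf χ), ((Fintype.card G : ℂ)⁻¹ • ∑ h : G, (((χ ^ k) h : ℂ)⁻¹ • σ h)) =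
      (Nat.card ↥χ.ker : ℂ)⁻¹ • ∑ h ∈ Finset.univ.filter (· ∈ χ.ker), σ h := by
  classical
  haveI : Fintype (G →* ℂˣ) := Fintype.ofFinite _
  rw [← sum_filter_proj_eq_inv_card_smul_sum σ χ.ker (Abelianization.commutator_subset_ker χ),
    filter_ker_le_ker_eq_image_pow χ, sum_image_pow_eq_sum_range χ]

omit [Fintype G] in
/-- **`⊕_{k} E_{χᵏ}(W) = W^{ker χ}`**: the sum of the eigenspaces of the powers of `χ` is the subspace on which `G`
acts through the cyclic quotient `Q = G/ker χ`. [cite: KopeliovichZemel2019, Theorem 7.3, Corollary 7.4 (proof)]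
[cite: SerreLinearRepresentations1977, §2.6 Theorem 8] -/
theorem iSup_iInf_eigenspace_pow_eq_invariants_ker [Finite G] :
    (⨆ k : ℕ, ⨅ g : G, Module.End.eigenspace (σ g) ((χ ^ k) g : ℂ)) =
      Representation.invariants (σ.comp χ.ker.subtype) := by
  haveI : Fintype G := Fintype.ofFinite _
  refine le_antisymm (iSup_le fun k ↦ iInf_eigenspace_le_invariants_of_le_ker σ fun g hg ↦ ?_) ?_
  · rw [MonoidHom.mem_ker] at hg ⊢
    rw [MonoidHom.pow_apply, hg, one_pow]
  · rw [← biSup_iInf_eigenspace_eq_invariants σ χ.ker (Abelianization.commutator_subset_ker χ)]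
    refine iSup₂_le fun ψ hψ ↦ ?_
    obtain ⟨k, -, rfl⟩ := exists_pow_eq_of_ker_le_ker χ hψ
    exact le_iSup (fun k : ℕ ↦ ⨅ g : G, Module.End.eigenspace (σ g) ((χ ^ k) g : ℂ)) k

/-- **`Σ_{k < o(χ)} dim E_{χᵏ}(W) = dim W^{ker χ}`**: the dimension of the part of `W` on which `G` acts through the
cyclic quotient `Q = G/ker χ` (all powers of `χ`, invertible or not — «the other parts […] come from non-invertible
powers of a character `χ ∈ Ĝ` that reduces to a faithful character of `Q`»).
[cite: KopeliovichZemel2019, Theorem 7.3, Corollary 7.4 (proof)] [cite: SerreLinearRepresentations1977, §2.6 Theorem 8] -/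
theorem sum_range_finrank_iInf_eigenspace_pow_eq_finrank_invariants [FiniteDimensional ℂ W] :
    ∑ k ∈ Finset.range (orderOf χ), finrank ℂ ↥(⨅ g : G, Module.End.eigenspace (σ g) ((χ ^ k) g : ℂ)) =
      finrank ℂ ↥(Representation.invariants (σ.comp χ.ker.subtype)) := by
  classical
  haveI : Fintype (G →* ℂˣ) := Fintype.ofFinite _
  rw [← sum_filter_finrank_iInf_eigenspace_eq_finrank_invariants σ χ.ker (Abelianization.commutator_subset_ker χ),
    filter_ker_le_ker_eq_image_pow χ, sum_image_pow_eq_sum_range χ]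

end Cyclic

/-! ### §4 `Σ_{χ(N)=1} dim E_χ(𝓗¹(M)) = g(M/N)` and `Σ_{k<o(χ)} dim E_{χᵏ}(𝓗¹(M)) = g(M/ker χ)` -/

section OneForms

/-- Invariants of `N ≤ G ≤ Γ` computed in `G` or in `Γ`: `W^{N} = W^{N.map G.subtype}`. [folklore] -/
private theorem invariants_comp_subtype_comp_eq {Γ : Type*} [Group Γ] {W : Type*} [AddCommGroup W] [Module ℂ W]
    (ρ : Representation ℂ Γ W) (G : Subgroup Γ) (N : Subgroup ↥G) :
    Representation.invariants ((ρ.comp G.subtype).comp N.subtype) =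
      Representation.invariants (ρ.comp (N.map G.subtype).subtype) := by
  ext v
  simp only [Representation.mem_invariants, MonoidHom.comp_apply, Subgroup.subtype_apply]
  constructor
  · rintro hv ⟨k, hk⟩
    obtain ⟨k', hk', rfl⟩ := Subgroup.mem_map.1 hk
    exact hv ⟨k', hk'⟩
  · rintro hv ⟨k', hk'⟩
    exact hv ⟨(k' : Γ), Subgroup.mem_map_of_mem _ hk'⟩

variable {M : Type*} [TopologicalSpace M] [ChartedSpace ℂ M] [IsManifold 𝓘(ℂ, ℂ) ω M]
  [CompactSpace M] [T2Space M] [PreconnectedSpace M] [Nonempty M] [Finite (autGroup M)]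
  (G : Subgroup (autGroup M)) [Fintype ↥G]

open OrbitSurface

/-- **`Σ_{χ ∈ Ĝ, χ(N) = 1} dim E_χ = g(M/N)`** for `G' ≤ N ⊴ G ≤ Aut M`: the total multiplicity in `𝓗¹(M)` of the
linear characters of `G` factoring through `G/N` is the genus of the intermediate abelian cover `M/N → M/G`
(`⊕_{χ(N)=1} E_χ = 𝓗¹(M)^N`, `dim 𝓗¹(M)^N = g(M/N)`). Here `N` is pushed into `Aut M` (`N.map G.subtype`).
[cite: FarkasKra1992, V.2.2 Corollary] [cite: KopeliovichZemel2019, §7, Theorem 7.3]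
[cite: SerreLinearRepresentations1977, §2.6 Theorem 8] -/
theorem finsum_mem_finrank_iInf_eigenspace_oneFormRep_eq_arithGenus (N : Subgroup ↥G) [N.Normal]
    (hN : commutator ↥G ≤ N) [Fintype ↥(N.map G.subtype)] :
    ∑ᶠ χ ∈ {χ : ↥G →* ℂˣ | N ≤ χ.ker},
        finrank ℂ ↥(⨅ h : ↥G, Module.End.eigenspace (oneFormRep M (h : autGroup M)) (χ h : ℂ)) =
      arithGenus (OrbitSurface ↥(N.map G.subtype) M) := by
  classical
  haveI : Module.Finite ℂ ↥(holomorphicOneForms M) := moduleFinite_holomorphicOneForms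
  have h1 : ∑ᶠ χ ∈ {χ : ↥G →* ℂˣ | N ≤ χ.ker},
      finrank ℂ ↥(⨅ h : ↥G, Module.End.eigenspace (oneFormRep M (h : autGroup M)) (χ h : ℂ)) =
        finrank ℂ ↥(Representation.invariants (((oneFormRep M).comp G.subtype).comp N.subtype)) :=
    finsum_mem_finrank_iInf_eigenspace_eq_finrank_invariants ((oneFormRep M).comp G.subtype) N hN
  rw [h1, invariants_comp_subtype_comp_eq (oneFormRep M) G N, finrank_invariants_oneFormRep_comp_subtype (N.map G.subtype)]

/-- **`Σ_{k < o(χ)} dim E_{χᵏ} = g(M/ker χ)`** for a linear character `χ` of `G ≤ Aut M`: the part of `𝓗¹(M)` on which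
`G` acts through the cyclic quotient `Q = G/ker χ` — all powers of `χ` — is the pull-back of `𝓗¹(Y_Q)`, `Y_Q = M/ker χ`
(the invertible powers alone give `RiemannSurfaceCyclicQuotientEigenspaces.sum_units_finrank_iInf_eigenspace_pow_eq`).
Here `ker χ` is pushed into `Aut M` (`χ.ker.map G.subtype`). [cite: KopeliovichZemel2019, Theorem 7.3, Corollary 7.4 (proof)]
[cite: FarkasKra1992, V.2.2 Corollary] -/
theorem sum_range_finrank_iInf_eigenspace_pow_oneFormRep_eq_arithGenus (χ : ↥G →* ℂˣ)
    [Fintype ↥(χ.ker.map G.subtype)] :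
    ∑ k ∈ Finset.range (orderOf χ),
        finrank ℂ ↥(⨅ h : ↥G, Module.End.eigenspace (oneFormRep M (h : autGroup M)) ((χ ^ k) h : ℂ)) =
      arithGenus (OrbitSurface ↥(χ.ker.map G.subtype) M) := by
  classical
  haveI : Module.Finite ℂ ↥(holomorphicOneForms M) := moduleFinite_holomorphicOneForms
  have h1 : ∑ k ∈ Finset.range (orderOf χ),
      finrank ℂ ↥(⨅ h : ↥G, Module.End.eigenspace (oneFormRep M (h : autGroup M)) ((χ ^ k) h : ℂ)) =
        finrank ℂ ↥(Representation.invariants (((oneFormRep M).comp G.subtype).comp χ.ker.subtype)) :=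
    sum_range_finrank_iInf_eigenspace_pow_eq_finrank_invariants χ ((oneFormRep M).comp G.subtype)
  rw [h1, invariants_comp_subtype_comp_eq (oneFormRep M) G χ.ker,
    finrank_invariants_oneFormRep_comp_subtype (χ.ker.map G.subtype)]

end OneForms

end RiemannSurface

end Literature.Geometry.Kaehler
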